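import Literature.AlgebraicGeometry.Motives.CartierDivisor
import Literature.AlgebraicGeometry.Resolution.AlterationsDimension
import HarnessLib

/-!
# Helpers for the dimension-2, `F`-finite cut of crux `CleanModels` (line `Sketch` rev 10)

Route `ResolutionOfSingularities/RadicialJung`, crux item `CleanModels`
(stmt-ResolutionOfSingularities-15917), line `Sketch` rev 10 (lead c2), stub
`stub_principalizationDimTwoFFinite` (the induction over a finite affine cover with Giraud's
theorem on affine opens). Generic scheme-theoretic helpers, all folklore:

* `exists_basicOpen_superset_disjoint` — in an affine open `U`, a closed set `C` and a closed set
  `M` which do not meet inside `U` are separated by a basic open: `C ∩ U ⊆ D(h)`, `D(h) ∩ M = ∅`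
  (comaximality of the two ideals);
* `exists_section_eq_pow_mul` — on a non-empty affine open `U` of an integral scheme every rational
  function `g` has a representative `b^p · g`, `b ≠ 0`, of its `K^p`-line which is a section
  over `U` (clear the denominator `d`: `b = d`, section `a d^{p-1}`);
* `isIso_morphismRestrict_of_le` — if `f` is an isomorphism over `U` it is one over every
  `V ≤ U`;
* `isClosed_singleton_of_isClosed_subtype` — on a Jacobson space a point closed in an open subset
  is closed;
* `toFunctionField_germ_top`, `functionFieldMap_germ` — the rational function of a global
  section, and its pull-back along a dominant morphism.
-/

noncomputable section

set_option linter.dupNamespace false -- mandated namespace of this single-conjunct summit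

open CategoryTheory AlgebraicGeometry TopologicalSpace IsLocalRing
open Literature.AlgebraicGeometry.Motives

namespace Summit.ResolutionOfSingularities.ResolutionOfSingularities.Theorems.RadicialJung.CleanModels

universe u

/-! ## Affine avoidance -/

/-- **Affine avoidance.** Let `U` be an affine open of a scheme `X`, and `C, M ⊆ X` closed sets
which do not meet inside `U`. Then some basic open `D(h) ⊆ U`, `h ∈ Γ(X, U)`, contains `C ∩ U`
and misses `M`: the ideals of the traces of `C` and `M` on `Spec Γ(X, U)` are comaximal,
`1 = a + h` with `a` vanishing on `C ∩ U` and `h` vanishing on `M ∩ U`. [folklore] -/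
theorem exists_basicOpen_superset_disjoint {X : Scheme.{u}} {U : X.Opens} (hU : IsAffineOpen U)
    {C M : Set X} (hC : IsClosed C) (hM : IsClosed M) (hCM : C ∩ M ∩ (U : Set X) = ∅) :
    ∃ h : Γ(X, U), C ∩ (U : Set X) ⊆ (X.basicOpen h : Set X) ∧
      (X.basicOpen h : Set X) ∩ M = ∅ := by
  classical
  -- the traces on `Spec Γ(X, U)`
  set φ := hU.fromSpec with hφ
  have hC' : IsClosed (φ.base ⁻¹' C) := hC.preimage φ.base.hom.continuous
  have hM' : IsClosed (φ.base ⁻¹' M) := hM.preimage φ.base.hom.continuous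
  obtain ⟨I, hI⟩ := (PrimeSpectrum.isClosed_iff_zeroLocus_ideal _).mp hC'
  obtain ⟨J, hJ⟩ := (PrimeSpectrum.isClosed_iff_zeroLocus_ideal _).mp hM'
  -- the two ideals are comaximal
  have hIJ : I ⊔ J = ⊤ := by
    rw [← PrimeSpectrum.zeroLocus_empty_iff_eq_top, PrimeSpectrum.zeroLocus_sup, ← hI, ← hJ,
      Set.eq_empty_iff_forall_notMem]
    rintro q ⟨hqC, hqM⟩
    have hq : φ.base q ∈ C ∩ M ∩ (U : Set X) :=
      ⟨⟨hqC, hqM⟩, hU.range_fromSpec ▸ Set.mem_range_self q⟩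
    rw [hCM] at hq
    exact hq
  obtain ⟨a, ha, h, hh, hah⟩ := Submodule.mem_sup.mp ((Ideal.eq_top_iff_one _).mp hIJ)
  refine ⟨h, ?_, ?_⟩
  · rintro x ⟨hxC, hxU⟩
    obtain ⟨q, rfl⟩ : x ∈ Set.range φ.base := by rw [hU.range_fromSpec]; exact hxU
    have hqI : q ∈ PrimeSpectrum.zeroLocus (I : Set Γ(X, U)) := by rw [← hI]; exact hxC
    have hhq : h ∉ q.asIdeal := fun hhq => q.2.ne_top ((Ideal.eq_top_iff_one _).mpr
      (hah ▸ Ideal.add_mem _ (hqI ha) hhq))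
    have hmem : q ∈ φ ⁻¹ᵁ X.basicOpen h := by
      rw [hU.fromSpec_preimage_basicOpen]
      exact hhq
    exact hmem
  · rw [Set.eq_empty_iff_forall_notMem]
    rintro x ⟨hxh, hxM⟩
    have hxU : x ∈ (U : Set X) := X.basicOpen_le h hxh
    obtain ⟨q, rfl⟩ : x ∈ Set.range φ.base := by rw [hU.range_fromSpec]; exact hxU
    have hqJ : q ∈ PrimeSpectrum.zeroLocus (J : Set Γ(X, U)) := by rw [← hJ]; exact hxM
    have hmem : q ∈ φ ⁻¹ᵁ X.basicOpen h := hxh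
    rw [hU.fromSpec_preimage_basicOpen] at hmem
    exact hmem (hqJ hh)

/-! ## A representative of the `K^p`-line regular on an affine open -/

/-- **Clearing denominators on an affine open.** On a non-empty affine open `U` of an integral
scheme `X`, for every rational function `g` and `p ≥ 1` there are `b ∈ K(X)`, `b ≠ 0`, and a
section `s ∈ Γ(X, U)` whose rational function is `b^p · g` (`g = a/d`, `b = d`, `s = a d^{p-1}`).
[folklore] -/
theorem exists_section_eq_pow_mul {X : Scheme.{u}} [IsIntegral X] {U : X.Opens}
    (hU : IsAffineOpen U) (hUne : (U : Set X).Nonempty) {p : ℕ} (hp : 0 < p)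
    (g : X.functionField) :
    ∃ (b : X.functionField) (s : Γ(X, U)), b ≠ 0 ∧
      X.presheaf.germ U (genericPoint X)
          ((genericPoint_spec X).specializes (Set.mem_univ hUne.some) |>.mem_open U.2
            hUne.some_mem) s = b ^ p * g := by
  haveI : Nonempty U := ⟨⟨_, hUne.some_mem⟩⟩
  haveI := functionField_isFractionRing_of_isAffineOpen X U hU
  obtain ⟨⟨a, d⟩, rfl⟩ := IsLocalization.mk'_surjective (nonZeroDivisors Γ(X, U)) g
  refine ⟨algebraMap Γ(X, U) X.functionField d, a * (d : Γ(X, U)) ^ (p - 1),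
    IsLocalization.to_map_ne_zero_of_mem_nonZeroDivisors _ le_rfl d.2, ?_⟩
  have hgerm : X.presheaf.germ U (genericPoint X)
      ((genericPoint_spec X).specializes (Set.mem_univ hUne.some) |>.mem_open U.2
        hUne.some_mem) (a * (d : Γ(X, U)) ^ (p - 1)) =
      algebraMap Γ(X, U) X.functionField (a * (d : Γ(X, U)) ^ (p - 1)) := rfl
  rw [hgerm, map_mul, map_pow]
  dsimp only
  obtain ⟨q, hq⟩ : ∃ q, p = q + 1 := Nat.exists_eq_succ_of_ne_zero hp.ne'
  subst hq
  rw [Nat.add_sub_cancel, pow_succ, mul_assoc, IsLocalization.mk'_spec', mul_comm]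

/-! ## Isomorphisms over smaller opens -/

/-- **If `f` restricts to an isomorphism over `U`, it restricts to an isomorphism over every
`V ≤ U`** (`f ∣_ V` is, up to the canonical identifications, the restriction of `f ∣_ U` to
`U ∩ V = V`). [folklore] -/
theorem isIso_morphismRestrict_of_le {X Y : Scheme.{u}} (f : X ⟶ Y) {U V : Y.Opens} (hVU : V ≤ U)
    [IsIso (f ∣_ U)] : IsIso (f ∣_ V) := by
  have hV : U.ι ''ᵁ (U.ι ⁻¹ᵁ V) = V := by
    rw [Scheme.Hom.image_preimage_eq_opensRange_inf, Scheme.Opens.opensRange_ι, inf_eq_right.mpr hVU]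
  have h1 : (MorphismProperty.isomorphisms Scheme.{u}) (f ∣_ U ∣_ (U.ι ⁻¹ᵁ V)) :=
    IsZariskiLocalAtTarget.restrict (P := MorphismProperty.isomorphisms Scheme.{u})
      ((MorphismProperty.isomorphisms.iff _).mpr ‹IsIso (f ∣_ U)›) _
  have h2 : (MorphismProperty.isomorphisms Scheme.{u}) (f ∣_ U.ι ''ᵁ (U.ι ⁻¹ᵁ V)) :=
    ((MorphismProperty.isomorphisms Scheme.{u}).arrow_mk_iso_iff
      (morphismRestrictRestrict f U (U.ι ⁻¹ᵁ V))).mp h1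
  rw [hV] at h2
  exact (MorphismProperty.isomorphisms.iff _).mp h2

/-! ## Closed points of open subsets of Jacobson spaces -/

/-- **On a Jacobson space, a point which is closed in an open subspace is closed**: its singleton
is locally closed. [folklore] -/
theorem isClosed_singleton_of_isClosed_subtype {X : Type*} [TopologicalSpace X] [JacobsonSpace X]
    {U : Set X} (hU : IsOpen U) (x : U) (hx : IsClosed ({x} : Set U)) :
    IsClosed ({(x : X)} : Set X) := by
  refine isClosed_singleton_of_isLocallyClosed_singleton ?_
  obtain ⟨C, hC, hCx⟩ := isClosed_induced_iff.mp hx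
  refine ⟨U, C, hU, hC, ?_⟩
  ext y
  constructor
  · rintro rfl
    refine ⟨x.2, ?_⟩
    have : x ∈ ((↑) : U → X) ⁻¹' C := by rw [hCx]; rfl
    exact this
  · rintro ⟨hyU, hyC⟩
    have : (⟨y, hyU⟩ : U) ∈ ((↑) : U → X) ⁻¹' C := hyC
    rw [hCx] at this
    exact congrArg Subtype.val this

/-! ## Rational functions of global sections -/

/-- The rational function of a section `s` over `U` read at any point `x ∈ U` is its germ at the
generic point (restated from `RatFn.toFunctionField_germ` with the membership proof of the
generic point as an argument). [folklore] -/
theorem toFunctionField_germ' {X : Scheme.{u}} [IsIntegral X] {U : X.Opens} {x : X} (hx : x ∈ U)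
    (hη : genericPoint X ∈ U) (s : Γ(X, U)) :
    RatFn.toFunctionField x (X.presheaf.germ U x hx s) = X.presheaf.germ U (genericPoint X) hη s :=
  RatFn.toFunctionField_germ hx s

/-- **Pull-back of the rational function of a section along a dominant morphism**: for
`h : X ⟶ Y` dominant between integral schemes and `s ∈ Γ(Y, U)` with `h x ∈ U`,
`h^♯ (s as a rational function) = (h^* s as a rational function)`, both read through the germs at
`x` and `h x`. [folklore] -/
theorem functionFieldMap_toFunctionField_germ {X Y : Scheme.{u}} [IsIntegral X] [IsIntegral Y]
    (h : X ⟶ Y) [IsDominant h] {U : Y.Opens} (x : X) (hx : h.base x ∈ U) (s : Γ(Y, U)) :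
    RatFn.functionFieldMap h (RatFn.toFunctionField (h.base x) (Y.presheaf.germ U (h.base x) hx s)) =
      RatFn.toFunctionField x (X.presheaf.germ (h ⁻¹ᵁ U) x hx (h.app U s)) := by
  rw [RatFn.functionFieldMap_toFunctionField, Scheme.Hom.germ_stalkMap_apply]

end Summit.ResolutionOfSingularities.ResolutionOfSingularities.Theorems.RadicialJung.CleanModels

end
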